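import Summits.BirchSwinnertonDyer.BirchSwinnertonDyer.Theorems.UniversalToricDescentTwinFullThreeAdicImageOverK
import HarnessLib

/-!
# Full `p`-adic image over a quadratic field, every ODD prime: `ρ̄_{E,pⁿ}` onto over `ℚ` (all `n`) and
# `p ∤ d_K` ⟹ `Γ_K → Aut_{ℤ_p}(T_pE_K)` onto; at `p ≥ 5` from `ρ̄_{E,p}` onto alone (Serre)

Route `UniversalToricDescent` (BirchSwinnertonDyer), `--supports` crux stmt-BirchSwinnertonDyer-23594 (the
`p = 3` case is `UniversalToricDescentTwin{,Full}ThreeAdicImageOverK`); namespace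
`Summit.BirchSwinnertonDyer.BirchSwinnertonDyer.Theorems.AdicImageOverK`. THEOREMS ONLY (no definition,
no named fact). Seat bsd-wall-utd-p2 g9. Written because the SAME binder — «every `ℤ_p`-automorphism of
`T_p(E_K)` is a Galois element» = Howard 2004 Thm. B's «`Gal(K̄/K) → Aut_{ℤ_p}(T)` surjective» =
Yan–Zhu 2026 Thm. 5.7's «`ρ_E(G_K) = Aut_{ℤ_p}(T_pE)`» = the tree's `HowardHypotheses.surjective`,
`hfull`, `perrinRiouHPMCAt_of_thm57`'s `hsurj` — is carried UNDISCHARGED at `p ≥ 5` by several cells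
(`Rank1Residual/PerrinRiouHeegnerPointMainConjecture`, X9/X10), although it follows from the census bit
(sur) over `ℚ` for every quadratic `K` with `p ∤ d_K` (in particular every Heegner field with `p` split).

* §1 `generalLinearGroup_eq_top_of_sq_mem_of_det` — `p` odd: a subgroup of `GL₂(𝔽_p)` containing every
  square and attaining every determinant is everything (`(1 x; 0 1) = (1 x/2; 0 1)²`, `(1 0; c 1)`
  likewise, `SL₂` by the `U·L·U` factorisation and the trick `(a b; 0 d) = ((a b; 0 d)L(1))·L(-1)`).
* §2 `forall_exists_mem_smul_eq_prime` — `E/F` (`F` perfect, `p ≠ 0`, `p` odd), `ρ̄_{E,p}` onto,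
  `H ≤ Γ_F` with all squares and `χ_p(H) = 𝔽_pˣ` ⟹ `H` meets every class of `Γ_F` modulo the fixer of
  `E[p]` (frame + `det ρ̄_p = χ_p`).
* §3 over `ℚ`, `K` quadratic with `p ∤ d_K` (`χ_p|_{Γ_K}` onto, tree
  `modNCyclotomicCharacter_surjective_of_forall_prime_dvd_not_dvd_discr`):
  `hasSurjectiveModNGaloisRep_prime_baseChange` (level `p`), `hasSurjectiveModNGaloisRep_prime_pow_baseChange`
  (levels `pⁿ` from the `ℚ`-tower, odd-power tower lemma of `UniversalToricDescentTorsionImageIndexTwo`),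
  `isUnit_mem_range_galoisRepTate_baseChange_of_forall` (Tate-module form),
  **`isUnit_mem_range_galoisRepTate_baseChange_of_five_le`** (`p ≥ 5`: from `ρ̄_{E,p}` onto ALONE, by
  `serre_hasSurjectiveModNGaloisRep_pow_holds`) and `…_of_five_le_of_split` (`K` imaginary quadratic with
  `p` split). At `p = 3` the `ℚ`-tower needs `9 ∤ N` (Wuthrich; Elkies' counter-examples are additive at
  `3`) — see `ThreeAdicImageOverK.isUnit_mem_range_galoisRepTate_baseChange_three_of_not_additive`.
BSD is not proved by any of this.

## References
* [SerreAbelianLadic1968] J.-P. Serre, *Abelian ℓ-adic representations* (1968), IV-23 Lemma 3, IV-27 Ex. 3.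
* [Serre1972] J.-P. Serre, Invent. Math. 15 (1972), §4.2, §5.3 (`det = χ_p`; the quadratic subfield `ℚ(√p*)`).
* [Howard2004] B. Howard, Compos. Math. 140 (2004), Thm. B (hypothesis). [YanZhu2024MainConjNonCM] Thm. 5.7.
-/

noncomputable section

open scoped Classical

set_option linter.dupNamespace false
set_option autoImplicit false

namespace Summit.BirchSwinnertonDyer.BirchSwinnertonDyer.Theorems.AdicImageOverK

open WeierstrassCurve Field Literature.NumberTheory.EllipticCurves
  Literature.NumberTheory.GaloisRepresentations
  Summit.BirchSwinnertonDyer.BirchSwinnertonDyer.Theorems.ThreeAdicImageOverK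

universe u

/-! ### §1 `GL₂(𝔽_p)`, `p` odd: squares and full determinant generate everything -/

section GL2

open Matrix

variable {p : ℕ} [Fact p.Prime] {M : Subgroup (GL (Fin 2) (ZMod p))}

/-- Matrices realised in `M` are closed under products. [folklore] -/
private theorem memMat_mul {A B : Matrix (Fin 2) (Fin 2) (ZMod p)}
    (hA : ∃ g ∈ M, (g : Matrix (Fin 2) (Fin 2) (ZMod p)) = A)
    (hB : ∃ g ∈ M, (g : Matrix (Fin 2) (Fin 2) (ZMod p)) = B) :
    ∃ g ∈ M, (g : Matrix (Fin 2) (Fin 2) (ZMod p)) = A * B := by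
  obtain ⟨g, hg, rfl⟩ := hA
  obtain ⟨h, hh, rfl⟩ := hB
  exact ⟨g * h, M.mul_mem hg hh, by rw [Units.val_mul]⟩

/-- A matrix written as a square of an invertible matrix lies in `M`. [folklore] -/
private theorem memMat_of_eq_sq (hsq : ∀ g : GL (Fin 2) (ZMod p), g * g ∈ M)
    {A B : Matrix (Fin 2) (Fin 2) (ZMod p)} (hB : B.det ≠ 0) (hAB : A = B * B) :
    ∃ g ∈ M, (g : Matrix (Fin 2) (Fin 2) (ZMod p)) = A := by
  rw [hAB]
  exact ⟨_, hsq (Matrix.GeneralLinearGroup.mkOfDetNeZero B hB), by rw [Units.val_mul]; rfl⟩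

/-- `(1 x; 0 1) = (1 x/2; 0 1)²` lies in `M` (`p` odd). [folklore] -/
private theorem memMat_upper (hp2 : p ≠ 2) (hsq : ∀ g : GL (Fin 2) (ZMod p), g * g ∈ M)
    (x : ZMod p) : ∃ g ∈ M, (g : Matrix (Fin 2) (Fin 2) (ZMod p)) = !![1, x; 0, 1] := by
  have h2 : (2 : ZMod p) ≠ 0 := by
    intro h
    have := (ZMod.natCast_eq_zero_iff 2 p).mp (by exact_mod_cast h)
    exact hp2 ((Nat.prime_dvd_prime_iff_eq (Fact.out) Nat.prime_two).mp this)
  refine memMat_of_eq_sq hsq (B := !![1, x * 2⁻¹; 0, 1]) (by rw [Matrix.det_fin_two_of]; simp) ?_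
  ext i j; fin_cases i <;> fin_cases j <;> simp [Matrix.mul_apply, Fin.sum_univ_two]
  rw [← mul_two, mul_assoc, inv_mul_cancel₀ h2, mul_one]

/-- `(1 0; c 1) = (1 0; c/2 1)²` lies in `M` (`p` odd). [folklore] -/
private theorem memMat_lower (hp2 : p ≠ 2) (hsq : ∀ g : GL (Fin 2) (ZMod p), g * g ∈ M)
    (c : ZMod p) : ∃ g ∈ M, (g : Matrix (Fin 2) (Fin 2) (ZMod p)) = !![1, 0; c, 1] := by
  have h2 : (2 : ZMod p) ≠ 0 := by
    intro h
    have := (ZMod.natCast_eq_zero_iff 2 p).mp (by exact_mod_cast h)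
    exact hp2 ((Nat.prime_dvd_prime_iff_eq (Fact.out) Nat.prime_two).mp this)
  refine memMat_of_eq_sq hsq (B := !![1, 0; c * 2⁻¹, 1]) (by rw [Matrix.det_fin_two_of]; simp) ?_
  ext i j; fin_cases i <;> fin_cases j <;> simp [Matrix.mul_apply, Fin.sum_univ_two]
  rw [← mul_two, mul_assoc, inv_mul_cancel₀ h2, mul_one]

/-- Factorisation of a determinant-one matrix with non-zero lower-left entry into three elementary
matrices (any field). [folklore] -/
private theorem sl_two_factor {k : Type*} [Field k] (a b c d : k) (hdet : a * d - b * c = 1)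
    (hc : c ≠ 0) :
    !![a, b; c, d] = !![1, (a - 1) * c⁻¹; 0, 1] * !![1, 0; c, 1] * !![1, (d - 1) * c⁻¹; 0, 1] := by
  have hci : c * c⁻¹ = 1 := mul_inv_cancel₀ hc
  ext i j; fin_cases i <;> fin_cases j
  · simp; linear_combination (1 - a) * hci
  · simp; linear_combination (-c⁻¹) * hdet + (-(b + (a - 1) * (d - 1) * c⁻¹)) * hci
  · simp
  · simp; linear_combination (1 - d) * hci

/-- Every matrix `(a b; c d)` of determinant `1` over `𝔽_p` (`p` odd) lies in `M`: for `c ≠ 0` it is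
`U · L · U`; for `c = 0`, `(a b; 0 d) = ((a b; 0 d)·L(1)) · L(-1)` and the first factor has lower-left
entry `d ≠ 0`. [folklore] -/
private theorem memMat_fin_two (hp2 : p ≠ 2) (hsq : ∀ g : GL (Fin 2) (ZMod p), g * g ∈ M)
    (a b c d : ZMod p) (hA : a * d - b * c = 1) :
    ∃ g ∈ M, (g : Matrix (Fin 2) (Fin 2) (ZMod p)) = !![a, b; c, d] := by
  -- the case of a non-zero lower-left entry
  have key : ∀ a b c d : ZMod p, a * d - b * c = 1 → c ≠ 0 →
      ∃ g ∈ M, (g : Matrix (Fin 2) (Fin 2) (ZMod p)) = !![a, b; c, d] := by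
    intro a b c d hA hc
    rw [sl_two_factor a b c d hA hc]
    exact memMat_mul (memMat_mul (memMat_upper hp2 hsq _) (memMat_lower hp2 hsq c))
      (memMat_upper hp2 hsq _)
  by_cases hc : c = 0
  · subst hc
    have hd : d ≠ 0 := by
      rintro rfl
      rw [mul_zero, mul_zero, sub_zero] at hA
      exact zero_ne_one hA
    have h1 : ∃ g ∈ M, (g : Matrix (Fin 2) (Fin 2) (ZMod p)) = !![a + b, b; d, d] :=
      key (a + b) b d d (by linear_combination hA) hd
    have h2 := memMat_mul h1 (memMat_lower hp2 hsq (-1))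
    have heq : !![a + b, b; d, d] * !![1, 0; -1, 1] = !![a, b; 0, d] := by
      ext i j; fin_cases i <;> fin_cases j <;> simp [Matrix.mul_apply, Fin.sum_univ_two]
    rwa [heq] at h2
  · exact key a b c d hA hc

/-- Every matrix of determinant `1` over `𝔽_p` (`p` odd) lies in `M`. [folklore] -/
private theorem memMat_of_det_eq_one (hp2 : p ≠ 2) (hsq : ∀ g : GL (Fin 2) (ZMod p), g * g ∈ M)
    (A : Matrix (Fin 2) (Fin 2) (ZMod p)) (hA : A.det = 1) :
    ∃ g ∈ M, (g : Matrix (Fin 2) (Fin 2) (ZMod p)) = A := by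
  rw [Matrix.eta_fin_two A] at hA ⊢
  rw [Matrix.det_fin_two_of] at hA
  exact memMat_fin_two hp2 hsq _ _ _ _ hA

/-- **A subgroup of `GL₂(𝔽_p)` (`p` odd) containing every square and attaining every determinant is
all of `GL₂(𝔽_p)`**: the squares give `SL₂(𝔽_p)` (every transvection is the square of a transvection,
and `SL₂(𝔽_p)` is generated by transvections), and `g = (g s⁻¹) s` with `det s = det g`, `s ∈ M`.
[folklore] -/
theorem generalLinearGroup_eq_top_of_sq_mem_of_det (hp2 : p ≠ 2) (M : Subgroup (GL (Fin 2) (ZMod p)))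
    (hsq : ∀ g : GL (Fin 2) (ZMod p), g * g ∈ M)
    (hdet : ∀ ν : (ZMod p)ˣ, ∃ s ∈ M, Matrix.GeneralLinearGroup.det s = ν) : M = ⊤ := by
  have hSL : ∀ g : GL (Fin 2) (ZMod p), Matrix.GeneralLinearGroup.det g = 1 → g ∈ M := by
    intro g hg
    have hg' : (g : Matrix (Fin 2) (Fin 2) (ZMod p)).det = 1 := by
      rw [← Matrix.GeneralLinearGroup.val_det_apply, hg, Units.val_one]
    obtain ⟨g', hg'M, hgg'⟩ := memMat_of_det_eq_one hp2 hsq _ hg'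
    rwa [← Units.ext hgg']
  refine eq_top_iff.mpr fun g _ ↦ ?_
  obtain ⟨s, hs, hsdet⟩ := hdet (Matrix.GeneralLinearGroup.det g)
  have h1 : g * s⁻¹ ∈ M := hSL (g * s⁻¹) (by rw [map_mul, map_inv, hsdet, mul_inv_cancel])
  simpa using M.mul_mem h1 hs

end GL2

/-! ### §2 Level `p` over a general field: squares + full `χ_p` ⟹ `H` acts on `E[p]` through all of `Aut(E[p])` -/

section LevelP

/-- **Level `p` over a general field** (`p` odd). Let `E/F` be an elliptic curve over a perfect field
with `p ≠ 0` in `F` and `ρ̄_{E,p}` onto, and let `H ≤ Γ_F` contain every square and attain every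
value of the mod-`p` cyclotomic character `χ_p`. Then every `γ ∈ Γ_F` agrees on `E[p]` with some
`h ∈ H` (frame `E[p] ≅ 𝔽_p²`, `det ρ̄_p = χ_p` by the Weil pairing,
`generalLinearGroup_eq_top_of_sq_mem_of_det`). [folklore] -/
theorem forall_exists_mem_smul_eq_prime {F : Type u} [Field F] [PerfectField F] (p : ℕ)
    [Fact p.Prime] [NeZero ((p : ℕ) : F)] (hp2 : p ≠ 2) (W : WeierstrassCurve F) [W.IsElliptic]
    (hsurj : W.HasSurjectiveModNGaloisRep p) (H : Subgroup (absoluteGaloisGroup F))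
    (hH : ∀ g : absoluteGaloisGroup F, g * g ∈ H)
    (hχ : ∀ ν : (ZMod p)ˣ, ∃ h ∈ H, modNCyclotomicCharacter F p h = ν) :
    ∀ γ : absoluteGaloisGroup F, ∃ h ∈ H,
      ∀ P : geomPoints W, P ∈ geomTorsion W (p : ℤ) → h • P = γ • P := by
  have hp : p.Prime := Fact.out
  have hpF : ((p : ℕ) : F) ≠ 0 := NeZero.ne _
  obtain ⟨e⟩ := nonempty_addEquiv_geomTorsion W p 1 le_rfl hpF
  rw [pow_one] at e
  obtain ⟨ρ, hρ⟩ := exists_rep_of_addEquiv W e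
  have hρs : Function.Surjective ρ := rep_surjective_of_hasSurjectiveModNGaloisRep W e ρ hρ hsurj
  set M : Subgroup (GL (Fin 2) (ZMod p)) := H.map ρ with hM
  have hsq : ∀ g : GL (Fin 2) (ZMod p), g * g ∈ M := by
    intro g
    obtain ⟨γ, rfl⟩ := hρs g
    exact ⟨γ * γ, hH γ, map_mul ρ γ γ⟩
  have hdet : ∀ ν : (ZMod p)ˣ, ∃ s ∈ M, Matrix.GeneralLinearGroup.det s = ν := by
    intro ν
    obtain ⟨h, hh, hχh⟩ := hχ ν
    refine ⟨ρ h, ⟨h, hh, rfl⟩, Units.ext ?_⟩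
    have hd := det_eq_modNCyclotomicCharacter W p hp.two_le e h _ (hρ h)
    rw [Matrix.GeneralLinearGroup.val_det_apply, hd, hχh]
  have htop : M = ⊤ := generalLinearGroup_eq_top_of_sq_mem_of_det hp2 M hsq hdet
  intro γ
  obtain ⟨h, hh, hhγ⟩ : ρ γ ∈ M := htop ▸ Subgroup.mem_top _
  refine ⟨h, hh, fun P hP ↦ ?_⟩
  have key : h • (⟨P, hP⟩ : geomTorsion W (p : ℤ)) = γ • ⟨P, hP⟩ :=
    e.injective (by rw [hρ, hρ, hhγ])
  exact congrArg Subtype.val key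

end LevelP

/-! ### §3 Over `ℚ`: quadratic `K` with `p ∤ d_K`, `p` odd -/

section OverQ

open NumberField IsDedekindDomain

variable (W : WeierstrassCurve ℚ) [W.IsElliptic] (K : Type) [Field K] [NumberField K]
  {p : ℕ} [Fact p.Prime]

/-- For a quadratic field `K` with `p ∤ d_K`, `Gal(ℚ̄/K) ≤ Γ_ℚ` contains every square and attains
every value of `χ_p` (`χ_p|_{Γ_K}` is onto because `K ∩ ℚ(ζ_p) = ℚ`:
`modNCyclotomicCharacter_surjective_of_forall_prime_dvd_not_dvd_discr`). [folklore] -/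
theorem sq_mem_range_and_forall_exists_modNCyclotomicCharacter_eq (h2 : Module.finrank ℚ K = 2)
    (hd : ¬ (p : ℤ) ∣ NumberField.discr K) :
    (∀ g : absoluteGaloisGroup ℚ, g * g ∈ (absGaloisRestrict ℚ K).range) ∧
      ∀ ν : (ZMod p)ˣ, ∃ h ∈ (absGaloisRestrict ℚ K).range, modNCyclotomicCharacter ℚ p h = ν := by
  have hp : p.Prime := Fact.out
  obtain ⟨-, hind⟩ :=
    Literature.NumberTheory.Automorphic.isOpen_range_absGaloisRestrict_and_index_eq_two ℚ K h2
  refine ⟨fun g ↦ Subgroup.mul_self_mem_of_index_two hind g, fun ν ↦ ?_⟩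
  haveI : NeZero ((p : ℕ) : K) := ⟨Nat.cast_ne_zero.mpr hp.ne_zero⟩
  haveI : NeZero ((p : ℕ) : ℚ) := ⟨Nat.cast_ne_zero.mpr hp.ne_zero⟩
  have hcop : ∀ q : ℕ, q.Prime → q ∣ p → ¬ ((q : ℤ) ∣ NumberField.discr K) := by
    intro q hq hqp
    rwa [(Nat.prime_dvd_prime_iff_eq hq hp).mp hqp]
  obtain ⟨σ, hσ⟩ := modNCyclotomicCharacter_surjective_of_forall_prime_dvd_not_dvd_discr K p hcop ν
  exact ⟨absGaloisRestrict ℚ K σ, ⟨σ, rfl⟩, by rw [modNCyclotomicCharacter_absGaloisRestrict ℚ K p σ, hσ]⟩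

/-- **`ρ̄_{E_K,p}` onto** for `E/ℚ` with `ρ̄_{E,p}` onto (`p` odd) and `K` quadratic with `p ∤ d_K`
(the only quadratic subfield of `ℚ(E[p])` is `ℚ(√p*)`, which is ramified at `p`). [folklore] -/
theorem hasSurjectiveModNGaloisRep_prime_baseChange (hp2 : p ≠ 2) (h2 : Module.finrank ℚ K = 2)
    (hd : ¬ (p : ℤ) ∣ NumberField.discr K) (hsurj : W.HasSurjectiveModNGaloisRep p) :
    (W.baseChange K).HasSurjectiveModNGaloisRep p := by
  have hp : p.Prime := Fact.out
  haveI : NeZero ((p : ℕ) : ℚ) := ⟨Nat.cast_ne_zero.mpr hp.ne_zero⟩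
  obtain ⟨hsq, hχ⟩ := sq_mem_range_and_forall_exists_modNCyclotomicCharacter_eq K h2 hd
  have h1 := forall_exists_mem_smul_eq_prime p hp2 W hsurj _ hsq hχ
  refine hasSurjectiveModNGaloisRep_baseChange_of_forall_exists W K p hsurj fun γ ↦ ?_
  obtain ⟨h, ⟨δ, rfl⟩, hh⟩ := h1 γ
  exact ⟨δ, hh⟩

/-- **The `p`-adic tower over `K`** (`p` odd): if `ρ̄_{E,pⁿ}` is onto over `ℚ` for every `n` and `K`
is quadratic with `p ∤ d_K`, then `Γ_K → Aut(E_K[pⁿ])` is onto for every `n` (`[Γ_ℚ : Γ_K] = 2` is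
prime to `p`: `ThreeAdicImageOverK.forall_exists_mem_smul_eq_pow`). [folklore] -/
theorem hasSurjectiveModNGaloisRep_prime_pow_baseChange (hp2 : p ≠ 2) (h2 : Module.finrank ℚ K = 2)
    (hd : ¬ (p : ℤ) ∣ NumberField.discr K)
    (hsurj : ∀ n : ℕ, W.HasSurjectiveModNGaloisRep ((p ^ n : ℕ) : ℤ)) (n : ℕ) :
    (W.baseChange K).HasSurjectiveModNGaloisRep ((p ^ n : ℕ) : ℤ) := by
  have hp : p.Prime := Fact.out
  haveI : NeZero ((p : ℕ) : ℚ) := ⟨Nat.cast_ne_zero.mpr hp.ne_zero⟩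
  obtain ⟨hsq, hχ⟩ := sq_mem_range_and_forall_exists_modNCyclotomicCharacter_eq K h2 hd
  have h1 : W.HasSurjectiveModNGaloisRep p := by simpa using hsurj 1
  have hlev := forall_exists_mem_smul_eq_prime p hp2 W h1 _ hsq hχ
  have hlevn := forall_exists_mem_smul_eq_pow W p (hp.odd_of_ne_two hp2) _ hsq hlev n
  refine hasSurjectiveModNGaloisRep_baseChange_of_forall_exists W K (p ^ n) (hsurj n) fun γ ↦ ?_
  obtain ⟨h, ⟨δ, rfl⟩, hh⟩ := hlevn γ
  exact ⟨δ, hh⟩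

/-- **`Γ_K → Aut_{ℤ_p}(T_pE_K)` is onto** (`p` odd, `K` quadratic with `p ∤ d_K`) as soon as every
`ρ̄_{E,pⁿ}` is onto over `ℚ` — the Tate-module form (`HowardHypotheses.surjective`, Yan–Zhu's
«`ρ_E(G_K) = Aut_{ℤ_p}(T_pE)`», BCS's (sur) over `K`). [cite: Howard2004, Thm. B (hypothesis)] -/
theorem isUnit_mem_range_galoisRepTate_baseChange_of_forall (hp2 : p ≠ 2)
    (h2 : Module.finrank ℚ K = 2) (hd : ¬ (p : ℤ) ∣ NumberField.discr K)
    (hsurj : ∀ n : ℕ, W.HasSurjectiveModNGaloisRep ((p ^ n : ℕ) : ℤ)) :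
    ∀ u : Module.End ℤ_[p] ((W.baseChange K).tateModule p), IsUnit u →
      u ∈ Set.range (galoisRepTate (W.baseChange K) p) := fun u hu ↦
  mem_range_galoisRepTate_of_forall_hasSurjectiveModNGaloisRep (W.baseChange K) p
    (hasSurjectiveModNGaloisRep_prime_pow_baseChange W K hp2 h2 hd hsurj) u hu

/-- **`p ≥ 5`: `ρ̄_{E,p}` onto over `ℚ` and `K` quadratic with `p ∤ d_K` ⟹ `Γ_K → Aut_{ℤ_p}(T_pE_K)`
onto** (the `ℚ`-tower is Serre's lifting lemma, tree theorem `serre_hasSurjectiveModNGaloisRep_pow_holds`).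
This discharges, at every `p ≥ 5`, the full-image-over-`K` binders of the tree (`hfull` /
`HowardHypotheses.surjective` / Yan–Zhu 5.7's «`ρ_E(G_K) = Aut_{ℤ_p}(T_pE)`») from the census bit
(sur) over `ℚ`. [cite: SerreAbelianLadic1968, IV-23 Lemma 3] [cite: Howard2004, Thm. B (hypothesis)] -/
theorem isUnit_mem_range_galoisRepTate_baseChange_of_five_le (h5 : 5 ≤ p)
    (h2 : Module.finrank ℚ K = 2) (hd : ¬ (p : ℤ) ∣ NumberField.discr K)
    (hsurj : W.HasSurjectiveModNGaloisRep p) :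
    ∀ u : Module.End ℤ_[p] ((W.baseChange K).tateModule p), IsUnit u →
      u ∈ Set.range (galoisRepTate (W.baseChange K) p) :=
  isUnit_mem_range_galoisRepTate_baseChange_of_forall W K (by omega) h2 hd
    (serre_hasSurjectiveModNGaloisRep_pow_holds W p h5 hsurj)

/-- The same over an imaginary quadratic `K` in which `p ≥ 5` SPLITS (`#{𝔭 ∣ p} = 2`, the (spl)
hypothesis of the Heegner-point literature): `p ∤ d_K` is automatic. [cite: Howard2004, Thm. B (hypothesis)] -/
theorem isUnit_mem_range_galoisRepTate_baseChange_of_five_le_of_split (h5 : 5 ≤ p)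
    (hK : IsImaginaryQuadratic K) (hsplit : ((Ideal.span {(p : ℤ)}).primesOver (𝓞 K)).ncard = 2)
    (hsurj : W.HasSurjectiveModNGaloisRep p) :
    ∀ u : Module.End ℤ_[p] ((W.baseChange K).tateModule p), IsUnit u →
      u ∈ Set.range (galoisRepTate (W.baseChange K) p) :=
  isUnit_mem_range_galoisRepTate_baseChange_of_five_le W K h5 hK.1
    (not_dvd_discr_of_ncard_primesOver (K := K) Fact.out (hsplit.trans hK.1.symm)) hsurj

end OverQ

end Summit.BirchSwinnertonDyer.BirchSwinnertonDyer.Theorems.AdicImageOverK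

end
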